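import Summits.Parity.BatemanHorn.Theorems.AlmostPrimeZerosSystemMomentDeficitAssemblyAlgebra

/-!
# Crux `SystemMomentDeficit` (stmt-Parity-11326), line `Ideator3Sketch`: assembly, part 2 (blocks)

The three covariance blocks of the assembly, over an abstract family of `0/1` indicators
`Zf (i, q)` (`i` a member of the system, `q ∈ PP(x)` a prime power) with the two inputs of the
line: the root-class bound `E 1_{i,q} ≤ 2D/q` and the termwise near-pair covariance bound
`E 1 · E 1' − E(1·1') ≤ C/(x+1)` for coprime `q, q'`:
* `ablock_le` — `E A_z − Var A_z = O(1)` (pairs inside `PP(z)²`, `z² ≤ x`);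
* `covU_ge`   — `Cov(A_z, A_x − A_z) ≥ −O(1)` (near pairs, same-prime pairs, prime-pair tail);
* `covN_ge`   — `Cov(A_z, N) ≥ −O(1)` given the decorrelated covariance bound (log-mass projection).

Notation (docstrings only).  `Y = x + 1`, `E g = Y⁻¹ Σ_{0 ≤ n ≤ x} g(n)`, `A_z = Σ_{t ∈ univ × PP(z)} Zf t`.
Everything is [folklore].
-/

namespace Summit.Parity.BatemanHorn.Cruxes.SystemMomentDeficit.Ideator3Sketch

open scoped BigOperators
open Finset Polynomial
open Literature.NumberTheory.Sieve
open Summit.Parity.BatemanHorn.Theorems.AlmostPrimeZeros.SystemMertens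


/-! ### The three blocks, over an abstract family of `0/1` indicators `Zf (i, q)` -/

/-- **Block `E A_z − Var A_z = O(1)`.**  Pair expansion over `(univ ×ˢ PP(z))²`: coprime pairs
(all CRT-near since `z² ≤ x`) through the termwise covariance bound, at most `2(x+1)` of them;
non-coprime pairs (incl. the diagonal, where `Z² = Z`) through `E1·E1' ≤ 4D²/(qq')` and the
same-prime harmonic mass `≤ 8`. [folklore] -/
theorem ablock_le :
    ∀ (k : ℕ) (Zf : Fin k × ℕ → ℕ → ℝ) (x z : ℕ) (D CpS : ℝ) (hD : 0 ≤ D)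
    (hCpS : 0 ≤ CpS) (hzx : z ≤ x) (hzz : z * z ≤ x)
    (hZf01 : ∀ t n, Zf t n = 0 ∨ Zf t n = 1)
    (he : ∀ t : Fin k × ℕ, t.2 ∈ (Nat.primesLE x ∪ ((Nat.primesLE x).filter (fun p => p ^ 2 ≤ x)).image (fun p => p ^ 2)) →
      (∑ n ∈ range (x + 1), Zf t n) / ((x : ℝ) + 1) ≤ 2 * D / (t.2 : ℝ))
    (hpair : ∀ t t' : Fin k × ℕ, t.2 ∈ (Nat.primesLE x ∪ ((Nat.primesLE x).filter (fun p => p ^ 2 ≤ x)).image (fun p => p ^ 2)) → t'.2 ∈ (Nat.primesLE x ∪ ((Nat.primesLE x).filter (fun p => p ^ 2 ≤ x)).image (fun p => p ^ 2)) → Nat.Coprime t.2 t'.2 →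
      (∑ n ∈ range (x + 1), Zf t n) / ((x : ℝ) + 1) * ((∑ n ∈ range (x + 1), Zf t' n) / ((x : ℝ) + 1)) -
        (∑ n ∈ range (x + 1), Zf t n * Zf t' n) / ((x : ℝ) + 1) ≤ CpS / ((x : ℝ) + 1))
    (hcnt : #(((Nat.primesLE x ∪ ((Nat.primesLE x).filter (fun p => p ^ 2 ≤ x)).image (fun p => p ^ 2)) ×ˢ (Nat.primesLE x ∪ ((Nat.primesLE x).filter (fun p => p ^ 2 ≤ x)).image (fun p => p ^ 2))).filter (fun qq : ℕ × ℕ => Nat.Coprime qq.1 qq.2 ∧ qq.1 * qq.2 ≤ x)) ≤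
      2 * (x + 1))
    (h8 : ∑ qq ∈ ((Nat.primesLE x ∪ ((Nat.primesLE x).filter (fun p => p ^ 2 ≤ x)).image (fun p => p ^ 2)) ×ˢ (Nat.primesLE x ∪ ((Nat.primesLE x).filter (fun p => p ^ 2 ≤ x)).image (fun p => p ^ 2))).filter (fun qq : ℕ × ℕ => ¬ Nat.Coprime qq.1 qq.2),
      (1 : ℝ) / ((qq.1 : ℝ) * (qq.2 : ℝ)) ≤ 8),
    (∑ n ∈ range (x + 1), ∑ t ∈ (univ : Finset (Fin k)) ×ˢ (Nat.primesLE z ∪ ((Nat.primesLE z).filter (fun p => p ^ 2 ≤ z)).image (fun p => p ^ 2)), Zf t n) / ((x : ℝ) + 1) -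
        (∑ n ∈ range (x + 1), (∑ t ∈ (univ : Finset (Fin k)) ×ˢ (Nat.primesLE z ∪ ((Nat.primesLE z).filter (fun p => p ^ 2 ≤ z)).image (fun p => p ^ 2)), Zf t n) ^ 2) / ((x : ℝ) + 1) +
      ((∑ n ∈ range (x + 1), ∑ t ∈ (univ : Finset (Fin k)) ×ˢ (Nat.primesLE z ∪ ((Nat.primesLE z).filter (fun p => p ^ 2 ≤ z)).image (fun p => p ^ 2)), Zf t n) / ((x : ℝ) + 1)) ^ 2 ≤
      (k : ℝ) ^ 2 * (2 * CpS + 32 * D ^ 2) := by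
  intro k Zf x z D CpS hD hCpS hzx hzz hZf01 he hpair hcnt h8
  have hY0 : (0 : ℝ) < (x : ℝ) + 1 := by positivity
  have hZf0 : ∀ t n, 0 ≤ Zf t n := fun t n => by rcases hZf01 t n with h | h <;> simp [h]
  have hmemx : ∀ t ∈ (univ : Finset (Fin k)) ×ˢ (Nat.primesLE z ∪ ((Nat.primesLE z).filter (fun p => p ^ 2 ≤ z)).image (fun p => p ^ 2)), t.2 ∈ (Nat.primesLE x ∪ ((Nat.primesLE x).filter (fun p => p ^ 2 ≤ x)).image (fun p => p ^ 2)) := fun t ht =>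
    PP_mono hzx (mem_product.1 ht).2
  have he0 : ∀ t : Fin k × ℕ, 0 ≤ (∑ n ∈ range (x + 1), Zf t n) / ((x : ℝ) + 1) := fun t =>
    div_nonneg (sum_nonneg fun n _ => hZf0 t n) hY0.le
  have he2_0 : ∀ t t' : Fin k × ℕ, 0 ≤ (∑ n ∈ range (x + 1), Zf t n * Zf t' n) / ((x : ℝ) + 1) :=
    fun t t' => div_nonneg (sum_nonneg fun n _ => mul_nonneg (hZf0 t n) (hZf0 t' n)) hY0.le
  have hpair' : ∀ t t' : Fin k × ℕ, t.2 ∈ (Nat.primesLE x ∪ ((Nat.primesLE x).filter (fun p => p ^ 2 ≤ x)).image (fun p => p ^ 2)) → t'.2 ∈ (Nat.primesLE x ∪ ((Nat.primesLE x).filter (fun p => p ^ 2 ≤ x)).image (fun p => p ^ 2)) →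
      (∑ n ∈ range (x + 1), Zf t n) / ((x : ℝ) + 1) * ((∑ n ∈ range (x + 1), Zf t' n) / ((x : ℝ) + 1)) ≤
        4 * D ^ 2 / ((t.2 : ℝ) * (t'.2 : ℝ)) := by
    intro t t' ht ht'
    have hq : (0 : ℝ) < t.2 := by
      have := (isPrimePow_and_le_of_mem_PP ht).2.1
      exact_mod_cast (by omega)
    have hq' : (0 : ℝ) < t'.2 := by
      have := (isPrimePow_and_le_of_mem_PP ht').2.1
      exact_mod_cast (by omega)
    calc _ ≤ (2 * D / (t.2 : ℝ)) * (2 * D / (t'.2 : ℝ)) :=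
          mul_le_mul (he t ht) (he t' ht') (he0 t') (by positivity)
      _ = 4 * D ^ 2 / ((t.2 : ℝ) * (t'.2 : ℝ)) := by field_simp; ring
  rw [deficit_sum_eq]
  -- termwise bound
  have hterm : ∀ t ∈ (univ : Finset (Fin k)) ×ˢ (Nat.primesLE z ∪ ((Nat.primesLE z).filter (fun p => p ^ 2 ≤ z)).image (fun p => p ^ 2)), ∀ t' ∈ (univ : Finset (Fin k)) ×ˢ (Nat.primesLE z ∪ ((Nat.primesLE z).filter (fun p => p ^ 2 ≤ z)).image (fun p => p ^ 2)),
      (∑ n ∈ range (x + 1), Zf t n) / ((x : ℝ) + 1) * ((∑ n ∈ range (x + 1), Zf t' n) / ((x : ℝ) + 1)) -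
          (∑ n ∈ range (x + 1), Zf t n * Zf t' n) / ((x : ℝ) + 1) +
        (if t = t' then (∑ n ∈ range (x + 1), Zf t n) / ((x : ℝ) + 1) else 0) ≤
      if Nat.Coprime t.2 t'.2 then CpS / ((x : ℝ) + 1) else 4 * D ^ 2 / ((t.2 : ℝ) * (t'.2 : ℝ)) := by
    intro t ht t' ht'
    have htx := hmemx t ht
    have ht'x := hmemx t' ht'
    by_cases hcop : Nat.Coprime t.2 t'.2
    · have hne : t ≠ t' := by
        rintro rfl
        have h2 := (isPrimePow_and_le_of_mem_PP htx).2.1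
        rw [Nat.coprime_self] at hcop
        omega
      rw [if_pos hcop, if_neg hne, add_zero]
      exact hpair t t' htx ht'x hcop
    · rw [if_neg hcop]
      by_cases heq : t = t'
      · subst heq
        rw [if_pos rfl]
        have hdiag : ∑ n ∈ range (x + 1), Zf t n * Zf t n = ∑ n ∈ range (x + 1), Zf t n :=
          sum_congr rfl fun n _ => by rcases hZf01 t n with h | h <;> simp [h]
        rw [hdiag]
        linarith [hpair' t t htx htx]
      · rw [if_neg heq, add_zero]
        linarith [hpair' t t' htx ht'x, he2_0 t t']
  refine (sum_le_sum fun t ht => sum_le_sum fun t' ht' => hterm t ht t' ht').trans ?_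
  rw [sum_univ_prod_sum_univ_prod (k := k) ((Nat.primesLE z ∪ ((Nat.primesLE z).filter (fun p => p ^ 2 ≤ z)).image (fun p => p ^ 2))) ((Nat.primesLE z ∪ ((Nat.primesLE z).filter (fun p => p ^ 2 ≤ z)).image (fun p => p ^ 2))) (fun q q' =>
    if Nat.Coprime q q' then CpS / ((x : ℝ) + 1) else 4 * D ^ 2 / ((q : ℝ) * (q' : ℝ)))]
  refine mul_le_mul_of_nonneg_left ?_ (by positivity)
  rw [sum_ite]
  -- coprime pairs: at most `2(x+1)` of them
  have hcnt' : (#(((Nat.primesLE z ∪ ((Nat.primesLE z).filter (fun p => p ^ 2 ≤ z)).image (fun p => p ^ 2)) ×ˢ (Nat.primesLE z ∪ ((Nat.primesLE z).filter (fun p => p ^ 2 ≤ z)).image (fun p => p ^ 2))).filter (fun qq : ℕ × ℕ => Nat.Coprime qq.1 qq.2)) : ℝ) ≤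
      2 * ((x : ℝ) + 1) := by
    have h2 : #(((Nat.primesLE z ∪ ((Nat.primesLE z).filter (fun p => p ^ 2 ≤ z)).image (fun p => p ^ 2)) ×ˢ (Nat.primesLE z ∪ ((Nat.primesLE z).filter (fun p => p ^ 2 ≤ z)).image (fun p => p ^ 2))).filter (fun qq : ℕ × ℕ => Nat.Coprime qq.1 qq.2)) ≤
        #(((Nat.primesLE x ∪ ((Nat.primesLE x).filter (fun p => p ^ 2 ≤ x)).image (fun p => p ^ 2)) ×ˢ (Nat.primesLE x ∪ ((Nat.primesLE x).filter (fun p => p ^ 2 ≤ x)).image (fun p => p ^ 2))).filter (fun qq : ℕ × ℕ => Nat.Coprime qq.1 qq.2 ∧ qq.1 * qq.2 ≤ x)) := by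
      refine card_le_card fun qq hqq => ?_
      rw [mem_filter, mem_product] at hqq ⊢
      obtain ⟨⟨h1, h2⟩, hc⟩ := hqq
      refine ⟨⟨PP_mono hzx h1, PP_mono hzx h2⟩, hc, ?_⟩
      exact le_trans (Nat.mul_le_mul (isPrimePow_and_le_of_mem_PP h1).2.2
        (isPrimePow_and_le_of_mem_PP h2).2.2) hzz
    exact_mod_cast h2.trans hcnt
  have hA : ∑ qq ∈ ((Nat.primesLE z ∪ ((Nat.primesLE z).filter (fun p => p ^ 2 ≤ z)).image (fun p => p ^ 2)) ×ˢ (Nat.primesLE z ∪ ((Nat.primesLE z).filter (fun p => p ^ 2 ≤ z)).image (fun p => p ^ 2))).filter (fun qq : ℕ × ℕ => Nat.Coprime qq.1 qq.2),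
      CpS / ((x : ℝ) + 1) ≤ 2 * CpS := by
    rw [sum_const, nsmul_eq_mul]
    calc _ ≤ 2 * ((x : ℝ) + 1) * (CpS / ((x : ℝ) + 1)) :=
          mul_le_mul_of_nonneg_right hcnt' (div_nonneg hCpS hY0.le)
      _ = 2 * CpS := by field_simp
  -- non-coprime pairs: harmonic mass `≤ 8`
  have hB : ∑ qq ∈ ((Nat.primesLE z ∪ ((Nat.primesLE z).filter (fun p => p ^ 2 ≤ z)).image (fun p => p ^ 2)) ×ˢ (Nat.primesLE z ∪ ((Nat.primesLE z).filter (fun p => p ^ 2 ≤ z)).image (fun p => p ^ 2))).filter (fun qq : ℕ × ℕ => ¬ Nat.Coprime qq.1 qq.2),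
      4 * D ^ 2 / ((qq.1 : ℝ) * (qq.2 : ℝ)) ≤ 4 * D ^ 2 * 8 := by
    calc ∑ qq ∈ ((Nat.primesLE z ∪ ((Nat.primesLE z).filter (fun p => p ^ 2 ≤ z)).image (fun p => p ^ 2)) ×ˢ (Nat.primesLE z ∪ ((Nat.primesLE z).filter (fun p => p ^ 2 ≤ z)).image (fun p => p ^ 2))).filter (fun qq : ℕ × ℕ => ¬ Nat.Coprime qq.1 qq.2),
          4 * D ^ 2 / ((qq.1 : ℝ) * (qq.2 : ℝ))
        = 4 * D ^ 2 * ∑ qq ∈ ((Nat.primesLE z ∪ ((Nat.primesLE z).filter (fun p => p ^ 2 ≤ z)).image (fun p => p ^ 2)) ×ˢ (Nat.primesLE z ∪ ((Nat.primesLE z).filter (fun p => p ^ 2 ≤ z)).image (fun p => p ^ 2))).filter (fun qq : ℕ × ℕ => ¬ Nat.Coprime qq.1 qq.2),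
            (1 : ℝ) / ((qq.1 : ℝ) * (qq.2 : ℝ)) := by
          rw [mul_sum]
          exact sum_congr rfl fun qq _ => by ring
      _ ≤ 4 * D ^ 2 * ∑ qq ∈ ((Nat.primesLE x ∪ ((Nat.primesLE x).filter (fun p => p ^ 2 ≤ x)).image (fun p => p ^ 2)) ×ˢ (Nat.primesLE x ∪ ((Nat.primesLE x).filter (fun p => p ^ 2 ≤ x)).image (fun p => p ^ 2))).filter (fun qq : ℕ × ℕ => ¬ Nat.Coprime qq.1 qq.2),
            (1 : ℝ) / ((qq.1 : ℝ) * (qq.2 : ℝ)) := by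
          refine mul_le_mul_of_nonneg_left ?_ (by positivity)
          refine sum_le_sum_of_subset_of_nonneg ?_ fun qq _ _ => by positivity
          exact filter_subset_filter _ (product_subset_product (PP_mono hzx) (PP_mono hzx))
      _ ≤ 4 * D ^ 2 * 8 := mul_le_mul_of_nonneg_left h8 (by positivity)
  linarith

/-- **Block `Cov(A_z, A_x − A_z) ≥ −O(1)`.**  Pair expansion over `(univ ×ˢ PP(z)) × (univ ×ˢ (PP(x) ∖ PP(z)))`:
near coprime pairs (`qq' ≤ x`) through the termwise covariance bound, at most `2(x+1)` of them;
all other pairs through `E1·E1' ≤ 4D²/(qq')`, the same-prime harmonic mass `≤ 8` and the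
prime-pair tail beyond the hyperbola. [folklore] -/
theorem covU_ge {k : ℕ} (Zf : Fin k × ℕ → ℕ → ℝ) (x z : ℕ) (D CpS C2 : ℝ) (hD : 0 ≤ D)
    (hCpS : 0 ≤ CpS) (hzx : z ≤ x)
    (hZf01 : ∀ t n, Zf t n = 0 ∨ Zf t n = 1)
    (he : ∀ t : Fin k × ℕ, t.2 ∈ (Nat.primesLE x ∪ ((Nat.primesLE x).filter (fun p => p ^ 2 ≤ x)).image (fun p => p ^ 2)) →
      (∑ n ∈ range (x + 1), Zf t n) / ((x : ℝ) + 1) ≤ 2 * D / (t.2 : ℝ))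
    (hpair : ∀ t t' : Fin k × ℕ, t.2 ∈ (Nat.primesLE x ∪ ((Nat.primesLE x).filter (fun p => p ^ 2 ≤ x)).image (fun p => p ^ 2)) → t'.2 ∈ (Nat.primesLE x ∪ ((Nat.primesLE x).filter (fun p => p ^ 2 ≤ x)).image (fun p => p ^ 2)) → Nat.Coprime t.2 t'.2 →
      (∑ n ∈ range (x + 1), Zf t n) / ((x : ℝ) + 1) * ((∑ n ∈ range (x + 1), Zf t' n) / ((x : ℝ) + 1)) -
        (∑ n ∈ range (x + 1), Zf t n * Zf t' n) / ((x : ℝ) + 1) ≤ CpS / ((x : ℝ) + 1))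
    (hcnt : #(((Nat.primesLE x ∪ ((Nat.primesLE x).filter (fun p => p ^ 2 ≤ x)).image (fun p => p ^ 2)) ×ˢ (Nat.primesLE x ∪ ((Nat.primesLE x).filter (fun p => p ^ 2 ≤ x)).image (fun p => p ^ 2))).filter (fun qq : ℕ × ℕ => Nat.Coprime qq.1 qq.2 ∧ qq.1 * qq.2 ≤ x)) ≤
      2 * (x + 1))
    (h8 : ∑ qq ∈ ((Nat.primesLE x ∪ ((Nat.primesLE x).filter (fun p => p ^ 2 ≤ x)).image (fun p => p ^ 2)) ×ˢ (Nat.primesLE x ∪ ((Nat.primesLE x).filter (fun p => p ^ 2 ≤ x)).image (fun p => p ^ 2))).filter (fun qq : ℕ × ℕ => ¬ Nat.Coprime qq.1 qq.2),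
      (1 : ℝ) / ((qq.1 : ℝ) * (qq.2 : ℝ)) ≤ 8)
    (hC2 : ∑ q ∈ (Nat.primesLE z ∪ ((Nat.primesLE z).filter (fun p => p ^ 2 ≤ z)).image (fun p => p ^ 2)), ∑ q' ∈ ((Nat.primesLE x ∪ ((Nat.primesLE x).filter (fun p => p ^ 2 ≤ x)).image (fun p => p ^ 2))).filter (fun q' => x < q * q'),
      (1 : ℝ) / ((q : ℝ) * (q' : ℝ)) ≤ C2) :
    -((k : ℝ) ^ 2 * (2 * CpS + 4 * D ^ 2 * (8 + C2))) ≤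
      (∑ n ∈ range (x + 1), (∑ t ∈ (univ : Finset (Fin k)) ×ˢ (Nat.primesLE z ∪ ((Nat.primesLE z).filter (fun p => p ^ 2 ≤ z)).image (fun p => p ^ 2)), Zf t n) *
          ∑ t' ∈ (univ : Finset (Fin k)) ×ˢ ((Nat.primesLE x ∪ ((Nat.primesLE x).filter (fun p => p ^ 2 ≤ x)).image (fun p => p ^ 2)) \ (Nat.primesLE z ∪ ((Nat.primesLE z).filter (fun p => p ^ 2 ≤ z)).image (fun p => p ^ 2))), Zf t' n) / ((x : ℝ) + 1) -
        (∑ n ∈ range (x + 1), ∑ t ∈ (univ : Finset (Fin k)) ×ˢ (Nat.primesLE z ∪ ((Nat.primesLE z).filter (fun p => p ^ 2 ≤ z)).image (fun p => p ^ 2)), Zf t n) / ((x : ℝ) + 1) *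
          ((∑ n ∈ range (x + 1), ∑ t' ∈ (univ : Finset (Fin k)) ×ˢ ((Nat.primesLE x ∪ ((Nat.primesLE x).filter (fun p => p ^ 2 ≤ x)).image (fun p => p ^ 2)) \ (Nat.primesLE z ∪ ((Nat.primesLE z).filter (fun p => p ^ 2 ≤ z)).image (fun p => p ^ 2))), Zf t' n) /
            ((x : ℝ) + 1)) := by
  have hY0 : (0 : ℝ) < (x : ℝ) + 1 := by positivity
  have hZf0 : ∀ t n, 0 ≤ Zf t n := fun t n => by rcases hZf01 t n with h | h <;> simp [h]
  have hmemx : ∀ t ∈ (univ : Finset (Fin k)) ×ˢ (Nat.primesLE z ∪ ((Nat.primesLE z).filter (fun p => p ^ 2 ≤ z)).image (fun p => p ^ 2)), t.2 ∈ (Nat.primesLE x ∪ ((Nat.primesLE x).filter (fun p => p ^ 2 ≤ x)).image (fun p => p ^ 2)) := fun t ht =>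
    PP_mono hzx (mem_product.1 ht).2
  have hmemx' : ∀ t ∈ (univ : Finset (Fin k)) ×ˢ ((Nat.primesLE x ∪ ((Nat.primesLE x).filter (fun p => p ^ 2 ≤ x)).image (fun p => p ^ 2)) \ (Nat.primesLE z ∪ ((Nat.primesLE z).filter (fun p => p ^ 2 ≤ z)).image (fun p => p ^ 2))), t.2 ∈ (Nat.primesLE x ∪ ((Nat.primesLE x).filter (fun p => p ^ 2 ≤ x)).image (fun p => p ^ 2)) := fun t ht =>
    (mem_sdiff.1 (mem_product.1 ht).2).1
  have he0 : ∀ t : Fin k × ℕ, 0 ≤ (∑ n ∈ range (x + 1), Zf t n) / ((x : ℝ) + 1) := fun t =>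
    div_nonneg (sum_nonneg fun n _ => hZf0 t n) hY0.le
  have he2_0 : ∀ t t' : Fin k × ℕ, 0 ≤ (∑ n ∈ range (x + 1), Zf t n * Zf t' n) / ((x : ℝ) + 1) :=
    fun t t' => div_nonneg (sum_nonneg fun n _ => mul_nonneg (hZf0 t n) (hZf0 t' n)) hY0.le
  have hpair' : ∀ t t' : Fin k × ℕ, t.2 ∈ (Nat.primesLE x ∪ ((Nat.primesLE x).filter (fun p => p ^ 2 ≤ x)).image (fun p => p ^ 2)) → t'.2 ∈ (Nat.primesLE x ∪ ((Nat.primesLE x).filter (fun p => p ^ 2 ≤ x)).image (fun p => p ^ 2)) →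
      (∑ n ∈ range (x + 1), Zf t n) / ((x : ℝ) + 1) * ((∑ n ∈ range (x + 1), Zf t' n) / ((x : ℝ) + 1)) ≤
        4 * D ^ 2 / ((t.2 : ℝ) * (t'.2 : ℝ)) := by
    intro t t' ht ht'
    have hq : (0 : ℝ) < t.2 := by
      have := (isPrimePow_and_le_of_mem_PP ht).2.1
      exact_mod_cast (by omega)
    have hq' : (0 : ℝ) < t'.2 := by
      have := (isPrimePow_and_le_of_mem_PP ht').2.1
      exact_mod_cast (by omega)
    calc _ ≤ (2 * D / (t.2 : ℝ)) * (2 * D / (t'.2 : ℝ)) :=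
          mul_le_mul (he t ht) (he t' ht') (he0 t') (by positivity)
      _ = 4 * D ^ 2 / ((t.2 : ℝ) * (t'.2 : ℝ)) := by field_simp; ring
  rw [cov_sum_eq]
  have hterm : ∀ t ∈ (univ : Finset (Fin k)) ×ˢ (Nat.primesLE z ∪ ((Nat.primesLE z).filter (fun p => p ^ 2 ≤ z)).image (fun p => p ^ 2)), ∀ t' ∈ (univ : Finset (Fin k)) ×ˢ ((Nat.primesLE x ∪ ((Nat.primesLE x).filter (fun p => p ^ 2 ≤ x)).image (fun p => p ^ 2)) \ (Nat.primesLE z ∪ ((Nat.primesLE z).filter (fun p => p ^ 2 ≤ z)).image (fun p => p ^ 2))),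
      -(if Nat.Coprime t.2 t'.2 ∧ t.2 * t'.2 ≤ x then CpS / ((x : ℝ) + 1)
        else 4 * D ^ 2 / ((t.2 : ℝ) * (t'.2 : ℝ))) ≤
      (∑ n ∈ range (x + 1), Zf t n * Zf t' n) / ((x : ℝ) + 1) -
        (∑ n ∈ range (x + 1), Zf t n) / ((x : ℝ) + 1) *
          ((∑ n ∈ range (x + 1), Zf t' n) / ((x : ℝ) + 1)) := by
    intro t ht t' ht'
    have htx := hmemx t ht
    have ht'x := hmemx' t' ht'
    by_cases hc : Nat.Coprime t.2 t'.2 ∧ t.2 * t'.2 ≤ x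
    · rw [if_pos hc]
      linarith [hpair t t' htx ht'x hc.1]
    · rw [if_neg hc]
      linarith [hpair' t t' htx ht'x, he2_0 t t']
  refine le_trans ?_ (sum_le_sum fun t ht => sum_le_sum fun t' ht' => hterm t ht t' ht')
  simp only [sum_neg_distrib, neg_le_neg_iff]
  rw [sum_univ_prod_sum_univ_prod (k := k) ((Nat.primesLE z ∪ ((Nat.primesLE z).filter (fun p => p ^ 2 ≤ z)).image (fun p => p ^ 2))) ((Nat.primesLE x ∪ ((Nat.primesLE x).filter (fun p => p ^ 2 ≤ x)).image (fun p => p ^ 2)) \ (Nat.primesLE z ∪ ((Nat.primesLE z).filter (fun p => p ^ 2 ≤ z)).image (fun p => p ^ 2))) (fun q q' =>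
    if Nat.Coprime q q' ∧ q * q' ≤ x then CpS / ((x : ℝ) + 1) else 4 * D ^ 2 / ((q : ℝ) * (q' : ℝ)))]
  refine mul_le_mul_of_nonneg_left ?_ (by positivity)
  rw [sum_ite]
  -- near coprime pairs: at most `2(x+1)` of them
  have hcnt' : (#(((Nat.primesLE z ∪ ((Nat.primesLE z).filter (fun p => p ^ 2 ≤ z)).image (fun p => p ^ 2)) ×ˢ ((Nat.primesLE x ∪ ((Nat.primesLE x).filter (fun p => p ^ 2 ≤ x)).image (fun p => p ^ 2)) \ (Nat.primesLE z ∪ ((Nat.primesLE z).filter (fun p => p ^ 2 ≤ z)).image (fun p => p ^ 2)))).filter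
      (fun qq : ℕ × ℕ => Nat.Coprime qq.1 qq.2 ∧ qq.1 * qq.2 ≤ x)) : ℝ) ≤ 2 * ((x : ℝ) + 1) := by
    have h2 : #(((Nat.primesLE z ∪ ((Nat.primesLE z).filter (fun p => p ^ 2 ≤ z)).image (fun p => p ^ 2)) ×ˢ ((Nat.primesLE x ∪ ((Nat.primesLE x).filter (fun p => p ^ 2 ≤ x)).image (fun p => p ^ 2)) \ (Nat.primesLE z ∪ ((Nat.primesLE z).filter (fun p => p ^ 2 ≤ z)).image (fun p => p ^ 2)))).filter
        (fun qq : ℕ × ℕ => Nat.Coprime qq.1 qq.2 ∧ qq.1 * qq.2 ≤ x)) ≤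
        #(((Nat.primesLE x ∪ ((Nat.primesLE x).filter (fun p => p ^ 2 ≤ x)).image (fun p => p ^ 2)) ×ˢ (Nat.primesLE x ∪ ((Nat.primesLE x).filter (fun p => p ^ 2 ≤ x)).image (fun p => p ^ 2))).filter (fun qq : ℕ × ℕ => Nat.Coprime qq.1 qq.2 ∧ qq.1 * qq.2 ≤ x)) :=
      card_le_card (filter_subset_filter _ (product_subset_product (PP_mono hzx) sdiff_subset))
    exact_mod_cast h2.trans hcnt
  have hA : ∑ qq ∈ ((Nat.primesLE z ∪ ((Nat.primesLE z).filter (fun p => p ^ 2 ≤ z)).image (fun p => p ^ 2)) ×ˢ ((Nat.primesLE x ∪ ((Nat.primesLE x).filter (fun p => p ^ 2 ≤ x)).image (fun p => p ^ 2)) \ (Nat.primesLE z ∪ ((Nat.primesLE z).filter (fun p => p ^ 2 ≤ z)).image (fun p => p ^ 2)))).filter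
      (fun qq : ℕ × ℕ => Nat.Coprime qq.1 qq.2 ∧ qq.1 * qq.2 ≤ x), CpS / ((x : ℝ) + 1) ≤ 2 * CpS := by
    rw [sum_const, nsmul_eq_mul]
    calc _ ≤ 2 * ((x : ℝ) + 1) * (CpS / ((x : ℝ) + 1)) :=
          mul_le_mul_of_nonneg_right hcnt' (div_nonneg hCpS hY0.le)
      _ = 2 * CpS := by field_simp
  -- the rest: non-coprime pairs (`≤ 8`) and far pairs (prime-pair tail `≤ C2`)
  have hB : ∑ qq ∈ ((Nat.primesLE z ∪ ((Nat.primesLE z).filter (fun p => p ^ 2 ≤ z)).image (fun p => p ^ 2)) ×ˢ ((Nat.primesLE x ∪ ((Nat.primesLE x).filter (fun p => p ^ 2 ≤ x)).image (fun p => p ^ 2)) \ (Nat.primesLE z ∪ ((Nat.primesLE z).filter (fun p => p ^ 2 ≤ z)).image (fun p => p ^ 2)))).filter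
      (fun qq : ℕ × ℕ => ¬ (Nat.Coprime qq.1 qq.2 ∧ qq.1 * qq.2 ≤ x)),
      4 * D ^ 2 / ((qq.1 : ℝ) * (qq.2 : ℝ)) ≤ 4 * D ^ 2 * (8 + C2) := by
    have hsplit' : ∑ qq ∈ ((Nat.primesLE z ∪ ((Nat.primesLE z).filter (fun p => p ^ 2 ≤ z)).image (fun p => p ^ 2)) ×ˢ ((Nat.primesLE x ∪ ((Nat.primesLE x).filter (fun p => p ^ 2 ≤ x)).image (fun p => p ^ 2)) \ (Nat.primesLE z ∪ ((Nat.primesLE z).filter (fun p => p ^ 2 ≤ z)).image (fun p => p ^ 2)))).filter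
        (fun qq : ℕ × ℕ => ¬ (Nat.Coprime qq.1 qq.2 ∧ qq.1 * qq.2 ≤ x)),
        (1 : ℝ) / ((qq.1 : ℝ) * (qq.2 : ℝ)) ≤
        ∑ qq ∈ ((Nat.primesLE x ∪ ((Nat.primesLE x).filter (fun p => p ^ 2 ≤ x)).image (fun p => p ^ 2)) ×ˢ (Nat.primesLE x ∪ ((Nat.primesLE x).filter (fun p => p ^ 2 ≤ x)).image (fun p => p ^ 2))).filter (fun qq : ℕ × ℕ => ¬ Nat.Coprime qq.1 qq.2),
          (1 : ℝ) / ((qq.1 : ℝ) * (qq.2 : ℝ)) +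
        ∑ q ∈ (Nat.primesLE z ∪ ((Nat.primesLE z).filter (fun p => p ^ 2 ≤ z)).image (fun p => p ^ 2)), ∑ q' ∈ ((Nat.primesLE x ∪ ((Nat.primesLE x).filter (fun p => p ^ 2 ≤ x)).image (fun p => p ^ 2))).filter (fun q' => x < q * q'),
          (1 : ℝ) / ((q : ℝ) * (q' : ℝ)) := by
      have hor : ((Nat.primesLE z ∪ ((Nat.primesLE z).filter (fun p => p ^ 2 ≤ z)).image (fun p => p ^ 2)) ×ˢ ((Nat.primesLE x ∪ ((Nat.primesLE x).filter (fun p => p ^ 2 ≤ x)).image (fun p => p ^ 2)) \ (Nat.primesLE z ∪ ((Nat.primesLE z).filter (fun p => p ^ 2 ≤ z)).image (fun p => p ^ 2)))).filter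
          (fun qq : ℕ × ℕ => ¬ (Nat.Coprime qq.1 qq.2 ∧ qq.1 * qq.2 ≤ x)) ⊆
          ((Nat.primesLE x ∪ ((Nat.primesLE x).filter (fun p => p ^ 2 ≤ x)).image (fun p => p ^ 2)) ×ˢ (Nat.primesLE x ∪ ((Nat.primesLE x).filter (fun p => p ^ 2 ≤ x)).image (fun p => p ^ 2))).filter (fun qq : ℕ × ℕ => ¬ Nat.Coprime qq.1 qq.2) ∪
            ((Nat.primesLE z ∪ ((Nat.primesLE z).filter (fun p => p ^ 2 ≤ z)).image (fun p => p ^ 2)) ×ˢ (Nat.primesLE x ∪ ((Nat.primesLE x).filter (fun p => p ^ 2 ≤ x)).image (fun p => p ^ 2))).filter (fun qq : ℕ × ℕ => x < qq.1 * qq.2) := by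
        intro qq hqq
        rw [mem_filter, mem_product] at hqq
        obtain ⟨⟨h1, h2⟩, hc⟩ := hqq
        rw [mem_union, mem_filter, mem_filter, mem_product, mem_product]
        by_cases hcop : Nat.Coprime qq.1 qq.2
        · right
          exact ⟨⟨h1, (mem_sdiff.1 h2).1⟩, not_le.1 fun hle => hc ⟨hcop, hle⟩⟩
        · left
          exact ⟨⟨PP_mono hzx h1, (mem_sdiff.1 h2).1⟩, hcop⟩
      refine (sum_le_sum_of_subset_of_nonneg hor fun qq _ _ => by positivity).trans ?_
      refine (sum_union_le_add fun qq => by positivity).trans ?_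
      rw [sum_sum_filter_eq_sum_product_filter]
    calc ∑ qq ∈ ((Nat.primesLE z ∪ ((Nat.primesLE z).filter (fun p => p ^ 2 ≤ z)).image (fun p => p ^ 2)) ×ˢ ((Nat.primesLE x ∪ ((Nat.primesLE x).filter (fun p => p ^ 2 ≤ x)).image (fun p => p ^ 2)) \ (Nat.primesLE z ∪ ((Nat.primesLE z).filter (fun p => p ^ 2 ≤ z)).image (fun p => p ^ 2)))).filter
          (fun qq : ℕ × ℕ => ¬ (Nat.Coprime qq.1 qq.2 ∧ qq.1 * qq.2 ≤ x)),
          4 * D ^ 2 / ((qq.1 : ℝ) * (qq.2 : ℝ))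
        = 4 * D ^ 2 * ∑ qq ∈ ((Nat.primesLE z ∪ ((Nat.primesLE z).filter (fun p => p ^ 2 ≤ z)).image (fun p => p ^ 2)) ×ˢ ((Nat.primesLE x ∪ ((Nat.primesLE x).filter (fun p => p ^ 2 ≤ x)).image (fun p => p ^ 2)) \ (Nat.primesLE z ∪ ((Nat.primesLE z).filter (fun p => p ^ 2 ≤ z)).image (fun p => p ^ 2)))).filter
            (fun qq : ℕ × ℕ => ¬ (Nat.Coprime qq.1 qq.2 ∧ qq.1 * qq.2 ≤ x)),
            (1 : ℝ) / ((qq.1 : ℝ) * (qq.2 : ℝ)) := by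
          rw [mul_sum]
          exact sum_congr rfl fun qq _ => by ring
      _ ≤ 4 * D ^ 2 * (8 + C2) := by
          refine mul_le_mul_of_nonneg_left ?_ (by positivity)
          linarith
  linarith

/-- **Block `Cov(A_z, N) ≥ −O(1)`: the log-mass projection.**  With `A_y = W + λ M`:
`Cov(A_z, N) = Cov(A_z − A_y, N) + Cov(W, N) + λ Cov(M, N)`; the first and third are bounded below
by positivity (`A_z − A_y, M, N ≥ 0`) and the bounds `E(A_z − A_y) ≤ c_A`, `λ E M · K ≤ c_M`,
`E N ≤ K`; the middle one is the decorrelated covariance bound. [folklore] -/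
theorem covN_ge {k : ℕ} (Zf : Fin k × ℕ → ℕ → ℝ) (x : ℕ) (Pz Py : Finset ℕ) (K cA cM CK lam : ℝ)
    (N W Mm : ℕ → ℝ) (hsub : Py ⊆ Pz) (hZf0 : ∀ t n, 0 ≤ Zf t n) (hlam : 0 ≤ lam)
    (hN0 : ∀ n, 0 ≤ N n) (hEN : (∑ n ∈ range (x + 1), N n) / ((x : ℝ) + 1) ≤ K)
    (hMm0 : ∀ n, 0 ≤ Mm n)
    (hW1 : ∀ n, ∑ i, ∑ q ∈ Py, Zf (i, q) n = W n + lam * Mm n)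
    (hEaY : (∑ n ∈ range (x + 1), ∑ i, ∑ q ∈ Pz \ Py, Zf (i, q) n) / ((x : ℝ) + 1) ≤ cA)
    (hlamM : lam * ((∑ n ∈ range (x + 1), Mm n) / ((x : ℝ) + 1)) * K ≤ cM)
    (hK1 : -CK ≤ (∑ n ∈ range (x + 1), W n * N n) / ((x : ℝ) + 1) -
      (∑ n ∈ range (x + 1), W n) / ((x : ℝ) + 1) * ((∑ n ∈ range (x + 1), N n) / ((x : ℝ) + 1))) :
    -(cA * K + cM + CK) ≤
      (∑ n ∈ range (x + 1), (∑ t ∈ (univ : Finset (Fin k)) ×ˢ Pz, Zf t n) * N n) / ((x : ℝ) + 1) -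
        (∑ n ∈ range (x + 1), ∑ t ∈ (univ : Finset (Fin k)) ×ˢ Pz, Zf t n) / ((x : ℝ) + 1) *
          ((∑ n ∈ range (x + 1), N n) / ((x : ℝ) + 1)) := by
  have hY0 : (0 : ℝ) < (x : ℝ) + 1 := by positivity
  have hEN0 : 0 ≤ (∑ n ∈ range (x + 1), N n) / ((x : ℝ) + 1) :=
    div_nonneg (sum_nonneg fun n _ => hN0 n) hY0.le
  have hK0 : 0 ≤ K := hEN0.trans hEN
  -- `a = (a − aY) + W + λ M` pointwise, with `a − aY ≥ 0` the count over `Pz ∖ Py`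
  have hsplit : ∀ n, ∑ t ∈ (univ : Finset (Fin k)) ×ˢ Pz, Zf t n =
      (∑ i, ∑ q ∈ Pz \ Py, Zf (i, q) n) + W n + lam * Mm n := by
    intro n
    rw [sum_product, add_assoc, ← hW1 n, ← sum_add_distrib]
    refine sum_congr rfl fun i _ => ?_
    rw [sum_sdiff (hsub)]
  have hR0 : ∀ n, 0 ≤ ∑ i, ∑ q ∈ Pz \ Py, Zf (i, q) n := fun n =>
    sum_nonneg fun i _ => sum_nonneg fun q _ => hZf0 _ n
  have e1 : ∑ n ∈ range (x + 1), (∑ t ∈ (univ : Finset (Fin k)) ×ˢ Pz, Zf t n) * N n =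
      ∑ n ∈ range (x + 1), (∑ i, ∑ q ∈ Pz \ Py, Zf (i, q) n) * N n +
        ∑ n ∈ range (x + 1), W n * N n + lam * ∑ n ∈ range (x + 1), Mm n * N n := by
    rw [mul_sum, ← sum_add_distrib, ← sum_add_distrib]
    exact sum_congr rfl fun n _ => by rw [hsplit n]; ring
  have e2 : ∑ n ∈ range (x + 1), ∑ t ∈ (univ : Finset (Fin k)) ×ˢ Pz, Zf t n =
      ∑ n ∈ range (x + 1), (∑ i, ∑ q ∈ Pz \ Py, Zf (i, q) n) +
        ∑ n ∈ range (x + 1), W n + lam * ∑ n ∈ range (x + 1), Mm n := by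
    rw [mul_sum, ← sum_add_distrib, ← sum_add_distrib]
    exact sum_congr rfl fun n _ => by rw [hsplit n]
  have e3 : (∑ n ∈ range (x + 1), (∑ t ∈ (univ : Finset (Fin k)) ×ˢ Pz, Zf t n) * N n) /
        ((x : ℝ) + 1) -
      (∑ n ∈ range (x + 1), ∑ t ∈ (univ : Finset (Fin k)) ×ˢ Pz, Zf t n) / ((x : ℝ) + 1) *
        ((∑ n ∈ range (x + 1), N n) / ((x : ℝ) + 1)) =
      ((∑ n ∈ range (x + 1), (∑ i, ∑ q ∈ Pz \ Py, Zf (i, q) n) * N n) / ((x : ℝ) + 1) -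
        (∑ n ∈ range (x + 1), (∑ i, ∑ q ∈ Pz \ Py, Zf (i, q) n)) / ((x : ℝ) + 1) *
          ((∑ n ∈ range (x + 1), N n) / ((x : ℝ) + 1))) +
      ((∑ n ∈ range (x + 1), W n * N n) / ((x : ℝ) + 1) -
        (∑ n ∈ range (x + 1), W n) / ((x : ℝ) + 1) * ((∑ n ∈ range (x + 1), N n) / ((x : ℝ) + 1))) +
      (lam * ((∑ n ∈ range (x + 1), Mm n * N n) / ((x : ℝ) + 1)) -
        lam * ((∑ n ∈ range (x + 1), Mm n) / ((x : ℝ) + 1)) * K +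
        lam * ((∑ n ∈ range (x + 1), Mm n) / ((x : ℝ) + 1)) *
          (K - (∑ n ∈ range (x + 1), N n) / ((x : ℝ) + 1))) := by
    rw [e1, e2]
    ring
  rw [e3]
  have hp1 : 0 ≤ (∑ n ∈ range (x + 1), (∑ i, ∑ q ∈ Pz \ Py, Zf (i, q) n) * N n) /
      ((x : ℝ) + 1) := div_nonneg (sum_nonneg fun n _ => mul_nonneg (hR0 n) (hN0 n)) hY0.le
  have hp2 : 0 ≤ (∑ n ∈ range (x + 1), (∑ i, ∑ q ∈ Pz \ Py, Zf (i, q) n)) / ((x : ℝ) + 1) :=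
    div_nonneg (sum_nonneg fun n _ => hR0 n) hY0.le
  have hp3 : 0 ≤ lam * ((∑ n ∈ range (x + 1), Mm n * N n) / ((x : ℝ) + 1)) :=
    mul_nonneg hlam (div_nonneg (sum_nonneg fun n _ => mul_nonneg (hMm0 n) (hN0 n)) hY0.le)
  have hp4 : 0 ≤ lam * ((∑ n ∈ range (x + 1), Mm n) / ((x : ℝ) + 1)) :=
    mul_nonneg hlam (div_nonneg (sum_nonneg fun n _ => hMm0 n) hY0.le)
  have hq1 : (∑ n ∈ range (x + 1), (∑ i, ∑ q ∈ Pz \ Py, Zf (i, q) n)) / ((x : ℝ) + 1) *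
      ((∑ n ∈ range (x + 1), N n) / ((x : ℝ) + 1)) ≤ cA * K :=
    mul_le_mul hEaY hEN hEN0 (hp2.trans hEaY)
  have hq2 : lam * ((∑ n ∈ range (x + 1), Mm n) / ((x : ℝ) + 1)) *
      (K - (∑ n ∈ range (x + 1), N n) / ((x : ℝ) + 1)) ≤ cM := by
    refine le_trans ?_ hlamM
    have hKN : K - (∑ n ∈ range (x + 1), N n) / ((x : ℝ) + 1) ≤ K := by linarith
    exact mul_le_mul_of_nonneg_left hKN hp4
  nlinarith [hp1, hp3, hq1, hq2, hK1]

end Summit.Parity.BatemanHorn.Cruxes.SystemMomentDeficit.Ideator3Sketch
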